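import Summits.AtomisticToContinuum.HydrodynamicLimit.Theorems.CorrectorPressureDecay.Negative.FastSectorSandwichFrame
import Summits.AtomisticToContinuum.HydrodynamicLimit.Theorems.AntiMazurCoboundariesExponentialCertificate

/-!
# Negative knowledge for `CorrectorPressureDecay` (stmt-AtomisticToContinuum-14135): the DISCRETE exponential
certificate (drefute gen 3, file 1/2)

Refuter `refuter-drefute-stmt-AtomisticToContinuum-14135-g3-0` (drefute gen 3 of the registered line
`Cruxes/CorrectorPressureDecay/Lines/kinetic-entropy-collision-budget.lean`), 2026-08-16. Consumed by
`Negative/DiscreteWindowOfCorrector.lean` (file 2/2: `CorrectorPressureDecay → DiscreteWindowPressureDecay →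
FastSectorDominance`, i.e. the line's open stub 5 is implied by the crux).

WHAT IS PROVED (sorry-free): `discreteCertificate_of_semigroup` — for an everywhere-defined measurable
measure-preserving semigroup `θ`, measurable `F, W`, `lag > 0` and `m, n ≥ 1`, sampling at the commensurate spacing
`lag/m`,

  `∫ exp(n⁻¹ Σ_{j=1}^{n} F∘θ_{j·lag/m}) dμ ≤ (∫ exp(2(F − lag⁻¹(W∘θ_lag − W))) dμ)^½ · (∫ exp((4m/(n·lag))|W|) dμ)^½`.

MECHANISM. Pathwise `F∘θ_t = G∘θ_t + lag⁻¹(W∘θ_{lag+t} − W∘θ_t)` with `G = F − lag⁻¹(W∘θ_lag − W)`; since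
`lag = m·(lag/m)` the corrector sum over the `n` samples TELESCOPES to `2m` boundary terms (`sum_shift_sub_sum`);
Cauchy–Schwarz (`lintegral_exp_add_le`); convexity of `exp` on finite uniform averages (`exp_avg_le`, twice);
invariance collapses every average along the semigroup (`lintegral_avg_comp_eq`). No time integrals and no joint
measurability are needed (contrast the continuous certificate `exponentialCertificate_proof`, stmt-14137). Also the
elementary `exp y ≤ 1 + e^B|y|` (`|y| ≤ B`) and its integrated form `∫ e^Y ≤ 1 + e^B ∫|Y|`, used by file 2/2.
Nothing here asserts a Theses decl.
-/

noncomputable section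

open MeasureTheory ProbabilityTheory InformationTheory Set Filter Topology
open scoped ENNReal

namespace Summit.AtomisticToContinuum.HydrodynamicLimit.Theorems.CorrectorPressureDecayNegative.DiscreteWindow

open Literature.MathematicalPhysics.KineticTheory (T3 V3 hsDiameter localGibbsLaw)
open Literature.Analysis.FluidPDE (HardSphereFlow Config)
open Summit.AtomisticToContinuum.HydrodynamicLimit.Theorems.CorrectorPressureDecayNegative.FastSectorSandwich
open Summit.AtomisticToContinuum.HydrodynamicLimit.Theorems.AntiMazurCoboundariesExponentialCertificate
  (exp_add_le_half)

/-! ## Elementary inequalities -/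

/-- Convexity of `exp` on a finite uniform average. [folklore] -/
theorem exp_avg_le {n : ℕ} (hn : 1 ≤ n) (a : Fin n → ℝ) :
    Real.exp ((n : ℝ)⁻¹ * ∑ j, a j) ≤ (n : ℝ)⁻¹ * ∑ j, Real.exp (a j) := by
  have hn' : (0 : ℝ) < n := by exact_mod_cast hn
  have h := (convexOn_exp).map_sum_le (t := Finset.univ) (w := fun _ : Fin n => (n : ℝ)⁻¹) (p := a)
    (fun _ _ => by positivity) ?_ (fun _ _ => Set.mem_univ _)
  · simpa only [smul_eq_mul, ← Finset.mul_sum] using h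
  · rw [Finset.sum_const, Finset.card_univ, Fintype.card_fin, nsmul_eq_mul, mul_inv_cancel₀ hn'.ne']

/-- `e^y ≤ 1 + e^B |y|` for `|y| ≤ B`. [folklore] -/
theorem exp_le_one_add_mul_abs {y B : ℝ} (hy : |y| ≤ B) : Real.exp y ≤ 1 + Real.exp B * |y| := by
  rcases le_or_gt y 0 with h | h
  · calc Real.exp y ≤ 1 := Real.exp_le_one_iff.2 h
      _ ≤ 1 + Real.exp B * |y| := le_add_of_nonneg_right (by positivity)
  · have hyB : y ≤ B := (le_abs_self y).trans hy
    have h1 : 1 - y ≤ Real.exp (-y) := Real.one_sub_le_exp_neg y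
    have h2 : Real.exp y * Real.exp (-y) = 1 := by rw [← Real.exp_add, add_neg_cancel, Real.exp_zero]
    have h3 : Real.exp y * (1 - y) ≤ 1 := by
      calc Real.exp y * (1 - y) ≤ Real.exp y * Real.exp (-y) :=
            mul_le_mul_of_nonneg_left h1 (Real.exp_nonneg _)
        _ = 1 := h2
    have h4 : Real.exp y ≤ Real.exp B := Real.exp_le_exp.2 hyB
    rw [abs_of_pos h]
    nlinarith [Real.exp_nonneg y, h3, h4, h]

/-- Shifted telescoping: `Σ_{j<n} a_{j+1+m} − Σ_{j<n} a_{j+1} = Σ_{j<m} a_{j+1+n} − Σ_{j<m} a_{j+1}`. [folklore] -/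
theorem sum_shift_sub_sum (a : ℕ → ℝ) (m n : ℕ) :
    ∑ j ∈ Finset.range n, a (j + 1 + m) - ∑ j ∈ Finset.range n, a (j + 1) =
      ∑ j ∈ Finset.range m, a (j + 1 + n) - ∑ j ∈ Finset.range m, a (j + 1) := by
  induction n with
  | zero => simp
  | succ n ih =>
    rw [Finset.sum_range_succ, Finset.sum_range_succ (fun j => a (j + 1))]
    have e1 := Finset.sum_range_succ' (fun j => a (j + 1 + n)) m
    have e2 := Finset.sum_range_succ (fun j => a (j + 1 + n)) m
    have e3 : ∑ j ∈ Finset.range m, a (j + 1 + (n + 1)) = ∑ j ∈ Finset.range m, a (j + 1 + 1 + n) :=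
      Finset.sum_congr rfl fun j _ => by congr 1; omega
    have e4 : a (0 + 1 + n) = a (n + 1) := by congr 1; omega
    have e5 : a (m + 1 + n) = a (n + 1 + m) := by congr 1; omega
    rw [e3]
    linarith [ih, e1, e2, e4, e5]

section Abstract

variable {X : Type*} [MeasurableSpace X]

/-- `(e^x)² = e^{2x}` in `ℝ≥0∞`. [folklore] -/
theorem ofReal_exp_rpow_two (x : ℝ) :
    ENNReal.ofReal (Real.exp x) ^ (2 : ℝ) = ENNReal.ofReal (Real.exp (2 * x)) := by
  rw [ENNReal.rpow_two, ← ENNReal.ofReal_pow (Real.exp_nonneg _), two_mul, Real.exp_add, sq]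

/-- **Cauchy–Schwarz for exponential moments**: `∫ e^{x+y} ≤ (∫ e^{2x})^½ (∫ e^{2y})^½`. [folklore] -/
theorem lintegral_exp_add_le {μ : Measure X} {x y : X → ℝ} (hx : Measurable x) (hy : Measurable y) :
    ∫⁻ z, ENNReal.ofReal (Real.exp (x z + y z)) ∂μ ≤
      (∫⁻ z, ENNReal.ofReal (Real.exp (2 * x z)) ∂μ) ^ (1 / 2 : ℝ) *
        (∫⁻ z, ENNReal.ofReal (Real.exp (2 * y z)) ∂μ) ^ (1 / 2 : ℝ) := by
  have hfm : AEMeasurable (fun z => ENNReal.ofReal (Real.exp (x z))) μ :=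
    (ENNReal.measurable_ofReal.comp hx.exp).aemeasurable
  have hgm : AEMeasurable (fun z => ENNReal.ofReal (Real.exp (y z))) μ :=
    (ENNReal.measurable_ofReal.comp hy.exp).aemeasurable
  have holder := ENNReal.lintegral_mul_le_Lp_mul_Lq μ Real.HolderConjugate.two_two hfm hgm
  simp only [Pi.mul_apply, ofReal_exp_rpow_two] at holder
  refine le_of_eq_of_le (lintegral_congr fun z => ?_) holder
  rw [Real.exp_add, ENNReal.ofReal_mul (Real.exp_nonneg _)]

/-- `∫ e^{Y} ≤ 1 + e^B ∫ |Y|` on a probability space when `|Y| ≤ B`. [folklore] -/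
theorem lintegral_exp_le_one_add {μ : Measure X} [IsProbabilityMeasure μ] {Y : X → ℝ} (hY : Measurable Y)
    {B : ℝ} (hB : ∀ z, |Y z| ≤ B) :
    ∫⁻ z, ENNReal.ofReal (Real.exp (Y z)) ∂μ ≤
      1 + ENNReal.ofReal (Real.exp B) * ∫⁻ z, ENNReal.ofReal |Y z| ∂μ := by
  calc ∫⁻ z, ENNReal.ofReal (Real.exp (Y z)) ∂μ
      ≤ ∫⁻ z, (1 + ENNReal.ofReal (Real.exp B) * ENNReal.ofReal |Y z|) ∂μ := by
        refine lintegral_mono fun z => ?_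
        calc ENNReal.ofReal (Real.exp (Y z)) ≤ ENNReal.ofReal (1 + Real.exp B * |Y z|) :=
              ENNReal.ofReal_le_ofReal (exp_le_one_add_mul_abs (hB z))
          _ = 1 + ENNReal.ofReal (Real.exp B) * ENNReal.ofReal |Y z| := by
              rw [ENNReal.ofReal_add zero_le_one (by positivity), ENNReal.ofReal_one,
                ENNReal.ofReal_mul (Real.exp_nonneg _)]
    _ = 1 + ENNReal.ofReal (Real.exp B) * ∫⁻ z, ENNReal.ofReal |Y z| ∂μ := by
        rw [lintegral_add_left measurable_const, lintegral_const, measure_univ, mul_one,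
          lintegral_const_mul _ hY.abs.ennreal_ofReal]

variable (θ : ℝ × X → X)

/-- **Invariance collapses averages along the flow**: for a `μ`-preserving map and nonnegative measurable `E`,
`∫ k⁻¹ Σ_j E(θ_{t_j} z) dμ = ∫ E dμ`. [folklore] -/
theorem lintegral_avg_comp_eq (hθ : ∀ t, Measurable fun z => θ (t, z)) (μ : Measure X)
    (hinv : ∀ t, MeasurePreserving (fun z => θ (t, z)) μ μ) {E : X → ℝ} (hE : Measurable E)
    (hE0 : ∀ z, 0 ≤ E z) {k : ℕ} (hk : 1 ≤ k) (t : Fin k → ℝ) :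
    ∫⁻ z, ENNReal.ofReal ((k : ℝ)⁻¹ * ∑ j, E (θ (t j, z))) ∂μ = ∫⁻ z, ENNReal.ofReal (E z) ∂μ := by
  have hk' : (0 : ℝ) < k := by exact_mod_cast hk
  have hmj : ∀ j, Measurable fun z => ENNReal.ofReal (E (θ (t j, z))) := fun j =>
    ENNReal.measurable_ofReal.comp (hE.comp (hθ _))
  have step : ∀ z, ENNReal.ofReal ((k : ℝ)⁻¹ * ∑ j, E (θ (t j, z))) =
      ENNReal.ofReal ((k : ℝ)⁻¹) * ∑ j, ENNReal.ofReal (E (θ (t j, z))) := fun z => by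
    rw [ENNReal.ofReal_mul (inv_nonneg.2 hk'.le), ENNReal.ofReal_sum_of_nonneg fun j _ => hE0 _]
  simp only [step]
  rw [lintegral_const_mul _ (Finset.measurable_sum _ fun j _ => hmj j), lintegral_finsetSum _ fun j _ => hmj j]
  have each : ∀ j, ∫⁻ z, ENNReal.ofReal (E (θ (t j, z))) ∂μ = ∫⁻ z, ENNReal.ofReal (E z) ∂μ := fun j =>
    (hinv (t j)).lintegral_comp (ENNReal.measurable_ofReal.comp hE)
  simp only [each]
  rw [Finset.sum_const, Finset.card_univ, Fintype.card_fin, nsmul_eq_mul, ← mul_assoc,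
    ENNReal.ofReal_inv_of_pos hk', ENNReal.ofReal_natCast,
    ENNReal.inv_mul_cancel (by exact_mod_cast hk'.ne') (ENNReal.natCast_ne_top k), one_mul]

/-- **The discrete exponential certificate for an everywhere-defined measure-preserving semigroup.** For
measurable `F, W`, `lag > 0`, `m, n ≥ 1`, sampling at spacing `lag/m`:
`∫ exp(n⁻¹ Σ_{j=1}^{n} F(θ_{j·lag/m} z)) dμ ≤ (∫ exp(2(F − lag⁻¹(W∘θ_lag − W))) dμ)^½ (∫ exp((4m/(n·lag))|W|) dμ)^½`.
Pathwise splitting + shifted telescoping of the corrector terms (`lag = m · (lag/m)`) + Cauchy–Schwarz +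
convexity of `exp` on finite averages + invariance. [folklore] -/
theorem discreteCertificate_of_semigroup (hθ : ∀ t, Measurable fun z => θ (t, z))
    (hsg : ∀ s t z, θ (s + t, z) = θ (s, θ (t, z))) (μ : Measure X) [IsProbabilityMeasure μ]
    (hinv : ∀ t, MeasurePreserving (fun z => θ (t, z)) μ μ) {F W : X → ℝ} (hF : Measurable F)
    (hW : Measurable W) {lag : ℝ} (hlag : 0 < lag) {m n : ℕ} (hm : 1 ≤ m) (hn : 1 ≤ n) :
    ∫⁻ z, ENNReal.ofReal (Real.exp ((n : ℝ)⁻¹ *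
        ∑ j : Fin n, F (θ ((((j : ℕ) : ℝ) + 1) * (lag / m), z)))) ∂μ ≤
      (∫⁻ z, ENNReal.ofReal (Real.exp (2 * (F z - lag⁻¹ * (W (θ (lag, z)) - W z)))) ∂μ) ^ (1 / 2 : ℝ) *
        (∫⁻ z, ENNReal.ofReal (Real.exp (4 * m / (n * lag) * |W z|)) ∂μ) ^ (1 / 2 : ℝ) := by
  have hm' : (0 : ℝ) < m := by exact_mod_cast hm
  have hn' : (0 : ℝ) < n := by exact_mod_cast hn
  set s : ℝ := lag / m with hs_def
  have hs : 0 < s := div_pos hlag hm'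
  have hms : (m : ℝ) * s = lag := by rw [hs_def]; field_simp
  -- the corrected observable and the sample values of the corrector
  set G : X → ℝ := fun z => F z - lag⁻¹ * (W (θ (lag, z)) - W z) with hG
  have hGm : Measurable G := hF.sub (((hW.comp (hθ lag)).sub hW).const_mul _)
  set aW : X → ℕ → ℝ := fun z k => W (θ ((k : ℝ) * s, z)) with haW
  -- pathwise: `F(θ_t z) = G(θ_t z) + lag⁻¹ (W(θ_{lag+t} z) − W(θ_t z))`
  have hpt : ∀ (t : ℝ) (z : X), F (θ (t, z)) = G (θ (t, z)) + lag⁻¹ * (W (θ (lag + t, z)) - W (θ (t, z))) := by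
    intro t z
    simp only [hG, hsg lag t z]
    ring
  -- the two pieces
  set avgG : X → ℝ := fun z => (n : ℝ)⁻¹ * ∑ j : Fin n, G (θ ((((j : ℕ) : ℝ) + 1) * s, z)) with havgG
  set Bd : X → ℝ := fun z => ((n : ℝ) * lag)⁻¹ *
    (∑ j ∈ Finset.range m, aW z (j + 1 + n) - ∑ j ∈ Finset.range m, aW z (j + 1)) with hBd
  -- Step 1: the pathwise identity
  have step1 : ∀ z, (n : ℝ)⁻¹ * ∑ j : Fin n, F (θ ((((j : ℕ) : ℝ) + 1) * s, z)) = avgG z + Bd z := by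
    intro z
    have hsum : ∑ j : Fin n, F (θ ((((j : ℕ) : ℝ) + 1) * s, z)) =
        ∑ j : Fin n, G (θ ((((j : ℕ) : ℝ) + 1) * s, z)) +
          lag⁻¹ * (∑ j ∈ Finset.range n, aW z (j + 1 + m) - ∑ j ∈ Finset.range n, aW z (j + 1)) := by
      have e1 : ∀ j : Fin n, F (θ ((((j : ℕ) : ℝ) + 1) * s, z)) =
          G (θ ((((j : ℕ) : ℝ) + 1) * s, z)) + lag⁻¹ * (aW z ((j : ℕ) + 1 + m) - aW z ((j : ℕ) + 1)) := by
        intro j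
        rw [hpt]
        simp only [haW]
        have t1 : lag + (((j : ℕ) : ℝ) + 1) * s = (((j : ℕ) + 1 + m : ℕ) : ℝ) * s := by
          rw [← hms]; push_cast; ring
        have t2 : (((j : ℕ) : ℝ) + 1) * s = (((j : ℕ) + 1 : ℕ) : ℝ) * s := by push_cast; ring
        rw [t1, ← t2]
      have e2 : ∑ j : Fin n, lag⁻¹ * (aW z ((j : ℕ) + 1 + m) - aW z ((j : ℕ) + 1)) =
          lag⁻¹ * (∑ j ∈ Finset.range n, aW z (j + 1 + m) - ∑ j ∈ Finset.range n, aW z (j + 1)) := by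
        rw [← Finset.mul_sum, Finset.sum_sub_distrib, Fin.sum_univ_eq_sum_range (fun j => aW z (j + 1 + m)) n,
          Fin.sum_univ_eq_sum_range (fun j => aW z (j + 1)) n]
      rw [Finset.sum_congr rfl fun j _ => e1 j, Finset.sum_add_distrib, e2]
    rw [hsum, sum_shift_sub_sum (aW z) m n]
    simp only [havgG, hBd]
    ring
  -- Step 2: measurability
  have havgGm : Measurable avgG :=
    (Finset.measurable_sum _ fun j _ => hGm.comp (hθ _)).const_mul _
  have haWm : ∀ k : ℕ, Measurable fun z => aW z k := fun k => hW.comp (hθ _)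
  have hBdm : Measurable Bd :=
    ((Finset.measurable_sum _ fun j _ => haWm _).sub (Finset.measurable_sum _ fun j _ => haWm _)).const_mul _
  -- Step 3: the corrected factor — convexity + invariance
  have fac1 : ∫⁻ z, ENNReal.ofReal (Real.exp (2 * avgG z)) ∂μ ≤
      ∫⁻ z, ENNReal.ofReal (Real.exp (2 * G z)) ∂μ := by
    have pt : ∀ z, Real.exp (2 * avgG z) ≤
        (n : ℝ)⁻¹ * ∑ j : Fin n, Real.exp (2 * G (θ ((((j : ℕ) : ℝ) + 1) * s, z))) := by
      intro z
      have h := exp_avg_le hn (fun j : Fin n => 2 * G (θ ((((j : ℕ) : ℝ) + 1) * s, z)))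
      refine le_of_eq_of_le ?_ h
      congr 1
      simp only [havgG, Finset.mul_sum]
      exact Finset.sum_congr rfl fun j _ => by ring
    calc ∫⁻ z, ENNReal.ofReal (Real.exp (2 * avgG z)) ∂μ
        ≤ ∫⁻ z, ENNReal.ofReal ((n : ℝ)⁻¹ *
            ∑ j : Fin n, Real.exp (2 * G (θ ((((j : ℕ) : ℝ) + 1) * s, z)))) ∂μ :=
          lintegral_mono fun z => ENNReal.ofReal_le_ofReal (pt z)
      _ = ∫⁻ z, ENNReal.ofReal (Real.exp (2 * G z)) ∂μ :=
          lintegral_avg_comp_eq θ hθ μ hinv (hGm.const_mul 2).exp (fun z => Real.exp_nonneg _) hn _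
  -- Step 4: the boundary factor — two-point and m-point convexity + invariance
  set c : ℝ := 4 * m / (n * lag) with hc
  have hc0 : 0 ≤ c := by rw [hc]; positivity
  have fac2 : ∫⁻ z, ENNReal.ofReal (Real.exp (2 * Bd z)) ∂μ ≤
      ∫⁻ z, ENNReal.ofReal (Real.exp (c * |W z|)) ∂μ := by
    -- the two m-point averages
    set xs : X → ℝ := fun z => (m : ℝ)⁻¹ * ∑ j : Fin m, c * |aW z ((j : ℕ) + 1 + n)| with hxs
    set ys : X → ℝ := fun z => (m : ℝ)⁻¹ * ∑ j : Fin m, c * |aW z ((j : ℕ) + 1)| with hys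
    have hkey : ((n : ℝ) * lag)⁻¹ * 2 = (m : ℝ)⁻¹ * c / 2 := by
      rw [hc]; field_simp; ring
    have pt1 : ∀ z, 2 * Bd z ≤ (xs z + ys z) / 2 := by
      intro z
      have hP : |∑ j ∈ Finset.range m, aW z (j + 1 + n)| ≤ ∑ j : Fin m, |aW z ((j : ℕ) + 1 + n)| := by
        rw [← Fin.sum_univ_eq_sum_range (fun j => aW z (j + 1 + n)) m]
        exact Finset.abs_sum_le_sum_abs _ _
      have hQ : |∑ j ∈ Finset.range m, aW z (j + 1)| ≤ ∑ j : Fin m, |aW z ((j : ℕ) + 1)| := by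
        rw [← Fin.sum_univ_eq_sum_range (fun j => aW z (j + 1)) m]
        exact Finset.abs_sum_le_sum_abs _ _
      have hdiff : ∑ j ∈ Finset.range m, aW z (j + 1 + n) - ∑ j ∈ Finset.range m, aW z (j + 1) ≤
          ∑ j : Fin m, |aW z ((j : ℕ) + 1 + n)| + ∑ j : Fin m, |aW z ((j : ℕ) + 1)| := by
        have h1 := le_abs_self (∑ j ∈ Finset.range m, aW z (j + 1 + n))
        have h2 := neg_abs_le (∑ j ∈ Finset.range m, aW z (j + 1))
        linarith
      have hnl : 0 ≤ ((n : ℝ) * lag)⁻¹ * 2 := by positivity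
      calc 2 * Bd z = (((n : ℝ) * lag)⁻¹ * 2) *
            (∑ j ∈ Finset.range m, aW z (j + 1 + n) - ∑ j ∈ Finset.range m, aW z (j + 1)) := by
            rw [hBd]; ring
        _ ≤ (((n : ℝ) * lag)⁻¹ * 2) *
            (∑ j : Fin m, |aW z ((j : ℕ) + 1 + n)| + ∑ j : Fin m, |aW z ((j : ℕ) + 1)|) :=
            mul_le_mul_of_nonneg_left hdiff hnl
        _ = (xs z + ys z) / 2 := by
            rw [hkey]
            simp only [hxs, hys, ← Finset.mul_sum]
            ring
    have pt2 : ∀ z, Real.exp (2 * Bd z) ≤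
        ((m : ℝ)⁻¹ * ∑ j : Fin m, Real.exp (c * |aW z ((j : ℕ) + 1 + n)|) +
          (m : ℝ)⁻¹ * ∑ j : Fin m, Real.exp (c * |aW z ((j : ℕ) + 1)|)) / 2 := by
      intro z
      have h1 : Real.exp (2 * Bd z) ≤ Real.exp (xs z / 2 + ys z / 2) :=
        Real.exp_le_exp.2 (by linarith [pt1 z])
      have h2 := exp_add_le_half (xs z / 2) (ys z / 2)
      have h3 : Real.exp (2 * (xs z / 2)) ≤ (m : ℝ)⁻¹ * ∑ j : Fin m, Real.exp (c * |aW z ((j : ℕ) + 1 + n)|) := by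
        rw [show 2 * (xs z / 2) = xs z by ring, hxs]
        exact exp_avg_le hm _
      have h4 : Real.exp (2 * (ys z / 2)) ≤ (m : ℝ)⁻¹ * ∑ j : Fin m, Real.exp (c * |aW z ((j : ℕ) + 1)|) := by
        rw [show 2 * (ys z / 2) = ys z by ring, hys]
        exact exp_avg_le hm _
      linarith
    -- integrate: each average collapses by invariance
    have hEm : Measurable fun z => Real.exp (c * |W z|) := (hW.abs.const_mul c).exp
    have hE0 : ∀ z, 0 ≤ Real.exp (c * |W z|) := fun z => Real.exp_nonneg _
    have hI1 : ∫⁻ z, ENNReal.ofReal ((m : ℝ)⁻¹ * ∑ j : Fin m, Real.exp (c * |aW z ((j : ℕ) + 1 + n)|)) ∂μ =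
        ∫⁻ z, ENNReal.ofReal (Real.exp (c * |W z|)) ∂μ :=
      lintegral_avg_comp_eq θ hθ μ hinv hEm hE0 hm (fun j : Fin m => (((j : ℕ) + 1 + n : ℕ) : ℝ) * s)
    have hI2 : ∫⁻ z, ENNReal.ofReal ((m : ℝ)⁻¹ * ∑ j : Fin m, Real.exp (c * |aW z ((j : ℕ) + 1)|)) ∂μ =
        ∫⁻ z, ENNReal.ofReal (Real.exp (c * |W z|)) ∂μ :=
      lintegral_avg_comp_eq θ hθ μ hinv hEm hE0 hm (fun j : Fin m => (((j : ℕ) + 1 : ℕ) : ℝ) * s)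
    have hnn1 : ∀ z, 0 ≤ (m : ℝ)⁻¹ * ∑ j : Fin m, Real.exp (c * |aW z ((j : ℕ) + 1 + n)|) := fun z =>
      mul_nonneg (inv_nonneg.2 hm'.le) (Finset.sum_nonneg fun j _ => Real.exp_nonneg _)
    have hnn2 : ∀ z, 0 ≤ (m : ℝ)⁻¹ * ∑ j : Fin m, Real.exp (c * |aW z ((j : ℕ) + 1)|) := fun z =>
      mul_nonneg (inv_nonneg.2 hm'.le) (Finset.sum_nonneg fun j _ => Real.exp_nonneg _)
    have hm1 : Measurable fun z => ENNReal.ofReal ((m : ℝ)⁻¹ * ∑ j : Fin m, Real.exp (c * |aW z ((j : ℕ) + 1 + n)|)) :=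
      ENNReal.measurable_ofReal.comp ((Finset.measurable_sum _ fun j _ => ((haWm _).abs.const_mul c).exp).const_mul _)
    have hm2 : Measurable fun z => ENNReal.ofReal ((m : ℝ)⁻¹ * ∑ j : Fin m, Real.exp (c * |aW z ((j : ℕ) + 1)|)) :=
      ENNReal.measurable_ofReal.comp ((Finset.measurable_sum _ fun j _ => ((haWm _).abs.const_mul c).exp).const_mul _)
    calc ∫⁻ z, ENNReal.ofReal (Real.exp (2 * Bd z)) ∂μ
        ≤ ∫⁻ z, ENNReal.ofReal (((m : ℝ)⁻¹ * ∑ j : Fin m, Real.exp (c * |aW z ((j : ℕ) + 1 + n)|) +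
            (m : ℝ)⁻¹ * ∑ j : Fin m, Real.exp (c * |aW z ((j : ℕ) + 1)|)) / 2) ∂μ :=
          lintegral_mono fun z => ENNReal.ofReal_le_ofReal (pt2 z)
      _ = ∫⁻ z, (ENNReal.ofReal ((m : ℝ)⁻¹ * ∑ j : Fin m, Real.exp (c * |aW z ((j : ℕ) + 1 + n)|)) +
            ENNReal.ofReal ((m : ℝ)⁻¹ * ∑ j : Fin m, Real.exp (c * |aW z ((j : ℕ) + 1)|))) / 2 ∂μ := by
          refine lintegral_congr fun z => ?_
          rw [ENNReal.ofReal_div_of_pos two_pos, ENNReal.ofReal_add (hnn1 z) (hnn2 z), ENNReal.ofReal_ofNat]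
      _ = 2⁻¹ * (∫⁻ z, ENNReal.ofReal ((m : ℝ)⁻¹ * ∑ j : Fin m, Real.exp (c * |aW z ((j : ℕ) + 1 + n)|)) ∂μ +
            ∫⁻ z, ENNReal.ofReal ((m : ℝ)⁻¹ * ∑ j : Fin m, Real.exp (c * |aW z ((j : ℕ) + 1)|)) ∂μ) := by
          have hm12 : Measurable fun z =>
              ENNReal.ofReal ((m : ℝ)⁻¹ * ∑ j : Fin m, Real.exp (c * |aW z ((j : ℕ) + 1 + n)|)) +
                ENNReal.ofReal ((m : ℝ)⁻¹ * ∑ j : Fin m, Real.exp (c * |aW z ((j : ℕ) + 1)|)) := hm1.add hm2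
          rw [← lintegral_add_left hm1, ← lintegral_const_mul _ hm12]
          exact lintegral_congr fun z => by rw [ENNReal.div_eq_inv_mul]
      _ = ∫⁻ z, ENNReal.ofReal (Real.exp (c * |W z|)) ∂μ := by
          rw [hI1, hI2, ← two_mul, ← mul_assoc, ENNReal.inv_mul_cancel two_ne_zero ENNReal.ofNat_ne_top, one_mul]
  -- Step 5: assemble (Cauchy–Schwarz)
  calc ∫⁻ z, ENNReal.ofReal (Real.exp ((n : ℝ)⁻¹ * ∑ j : Fin n, F (θ ((((j : ℕ) : ℝ) + 1) * s, z)))) ∂μ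
      = ∫⁻ z, ENNReal.ofReal (Real.exp (avgG z + Bd z)) ∂μ := lintegral_congr fun z => by rw [step1 z]
    _ ≤ (∫⁻ z, ENNReal.ofReal (Real.exp (2 * avgG z)) ∂μ) ^ (1 / 2 : ℝ) *
          (∫⁻ z, ENNReal.ofReal (Real.exp (2 * Bd z)) ∂μ) ^ (1 / 2 : ℝ) := lintegral_exp_add_le havgGm hBdm
    _ ≤ (∫⁻ z, ENNReal.ofReal (Real.exp (2 * G z)) ∂μ) ^ (1 / 2 : ℝ) *
          (∫⁻ z, ENNReal.ofReal (Real.exp (c * |W z|)) ∂μ) ^ (1 / 2 : ℝ) :=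
        mul_le_mul' (ENNReal.rpow_le_rpow fac1 (by norm_num)) (ENNReal.rpow_le_rpow fac2 (by norm_num))

end Abstract


/-! ## Small frame helpers (used by file 2/2) -/

/-- Each translation of the flat torus is continuous. [folklore] -/
theorem torus_continuous_translate (x : T3) :
    Continuous ((Literature.Analysis.FluidPDE.Torus.geometry (Fin 3)).translate x) :=
  continuous_const.add Literature.Analysis.FunctionSpaces.Torus.continuous_proj

/-- The one-body observable of the crux is continuous. [folklore] -/
theorem continuous_fluxObs {θ : ℝ} {u₀ : V3} {φ : T3 → ℝ} {g : V3 → ℝ} (hφ : Continuous φ)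
    (hg : Continuous g) (N : ℕ) : Continuous (fluxObs θ u₀ φ g N) := by
  unfold fluxObs
  fun_prop


end Summit.AtomisticToContinuum.HydrodynamicLimit.Theorems.CorrectorPressureDecayNegative.DiscreteWindow

end
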